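import Summits.AtomisticToContinuum.HydrodynamicLimit.Theorems.InformationPercolationEngineChaosClosesEulerReductionFields
import Summits.AtomisticToContinuum.HydrodynamicLimit.Theorems.InformationPercolationEngineChaosClosesEulerWindowedInvariance
import Summits.AtomisticToContinuum.HydrodynamicLimit.Theorems.InformationPercolationEngineChaosClosesEulerReadoutMeasurable
import HarnessLib

/-!
# Collisional pressure value in band (crux `ChaosClosesEuler`, stmt-AtomisticToContinuum-15141, line `Sketch`,
# stub `stub_pressureValueOfEnskog`) — helper C: the time tent, the space cone and the smoothed coefficient

WHAT. Deterministic window bookkeeping for the passage between the `r`-WINDOWED collision statistics (tent in time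
`bt a = r⁻¹ (1 − |a|/r)₊`, cone in space `b_r(x, x₀)`) and INSTANTANEOUS coefficients:

* the tent has unit mass, mass `≤ 1` on every set, mass exactly `1` on every window containing its support
  `[s − r, s + r]`, mass `0` past the window, and mass exactly `1/2` on the half window `[s, s + r]`
  (`integral_tent`, `setIntegral_tent_le_one`, `setIntegral_tent_eq_one`, `setIntegral_tent_eq_zero`,
  `integral_tent_half`);
* the smoothed coefficient `ã(s, x) = ∫_{t₀ ∈ [0,t]} ∫_{x₀} a(t₀, x₀) bt(s − t₀) b_r(x, x₀)` of a continuous `a` is bounded by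
  `sup |a|`, equals `a(s, x)` up to the `r`-modulus of `a` for `s ∈ [r, t − r]`, and vanishes for `s ≥ t + r`
  (`abs_smoothCoeff_le`, `abs_smoothCoeff_sub_le`, `smoothCoeff_eq_zero`).

References: C. Cercignani, R. Illner, M. Pulvirenti, *The Mathematical Theory of Dilute Gases* (1994), App. 4.A
(window reduction); elementary calculus otherwise.
-/

noncomputable section

namespace Summit.AtomisticToContinuum.HydrodynamicLimit.Theorems.ChaosClosesEulerPressureValue

open scoped BigOperators Topology Classical MeasureTheory ENNReal InnerProductSpace
open Filter Set MeasureTheory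
open Literature.MathematicalPhysics.KineticTheory
open Literature.Analysis.FluidPDE
open Summit.AtomisticToContinuum.HydrodynamicLimit.Theorems.LocalSecondLawNegative
open Summit.AtomisticToContinuum.HydrodynamicLimit.Theorems.LocalSecondLawLedger
open Summit.AtomisticToContinuum.HydrodynamicLimit.Theorems.LocalSecondLawLedger.L
  (Mmom rhoC_eq_sum momC_apply_eq_sum momC_eq_sum kinC_eq_trace norm_sq_eq_sum)

/-- The truncated stress mark `𝒯[L,k,l]` (local notation for an explicit lambda). -/
local notation3 "𝒯[" L ", " k ", " l "]" => fun q : V3 × V3 × V3 =>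
  min |⟪q.2.1 - q.2.2, q.1⟫_ℝ| (4 * L) * (speedCutoff L ‖q.2.1‖ * speedCutoff L ‖q.2.2‖) * (clip1 (q.1 k) * clip1 (q.1 l))

/-- The dominating mark `ℬ[L]` (local notation for an explicit lambda). -/
local notation3 "ℬ[" L "]" => fun q : V3 × V3 × V3 => 4 * L * (speedCutoff L ‖q.2.1‖ * speedCutoff L ‖q.2.2‖)

/-! ## §1 The time tent `bt a = r⁻¹ (1 − |a|/r)₊` -/

/-- The tent vanishes outside `(−r, r)`. [folklore] -/
theorem tent_eq_zero_of_le {r : ℝ} (hr : 0 < r) {a : ℝ} (h : r ≤ |a|) : r⁻¹ * max (1 - |a| / r) 0 = 0 := by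
  have h1 : 1 - |a| / r ≤ 0 := by rw [sub_nonpos, le_div_iff₀ hr, one_mul]; exact h
  rw [max_eq_right h1, mul_zero]

/-- The tent is continuous. [folklore] -/
theorem continuous_tent (r : ℝ) : Continuous fun a : ℝ => r⁻¹ * max (1 - |a| / r) 0 := by fun_prop

/-- The tent read backwards from `s` is continuous. [folklore] -/
theorem continuous_tent_sub (r s : ℝ) : Continuous fun t₀ : ℝ => r⁻¹ * max (1 - |s - t₀| / r) 0 := by fun_prop

/-- The tent is integrable on `ℝ` (continuous, supported in `[−r, r]`). [folklore] -/
theorem integrable_tent {r : ℝ} (hr : 0 < r) : Integrable fun a : ℝ => r⁻¹ * max (1 - |a| / r) 0 := by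
  refine (continuous_tent r).integrable_of_hasCompactSupport ?_
  refine HasCompactSupport.of_support_subset_isCompact (isCompact_Icc (a := -r) (b := r)) fun a ha => ?_
  by_contra hmem
  refine ha (tent_eq_zero_of_le hr ?_)
  simp only [mem_Icc, not_and_or, not_le] at hmem
  rcases hmem with h | h
  · rw [abs_of_neg (by linarith)]; linarith
  · rw [abs_of_pos (by linarith)]; linarith

/-- The tent read backwards from `s` is integrable on `ℝ`. [folklore] -/
theorem integrable_tent_sub {r : ℝ} (hr : 0 < r) (s : ℝ) :
    Integrable fun t₀ : ℝ => r⁻¹ * max (1 - |s - t₀| / r) 0 :=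
  (integrable_tent hr).comp_sub_left s

/-- **Half mass on the half window**: `∫_{s}^{s+r} bt(s − t₀) dt₀ = 1/2`. [folklore] -/
theorem integral_tent_half {r : ℝ} (hr : 0 < r) (s : ℝ) :
    ∫ t₀ in s..(s + r), r⁻¹ * max (1 - |s - t₀| / r) 0 = 1 / 2 := by
  have hcongr : ∫ t₀ in s..(s + r), r⁻¹ * max (1 - |s - t₀| / r) 0 = ∫ t₀ in s..(s + r), r⁻¹ * (1 - (t₀ - s) / r) := by
    refine intervalIntegral.integral_congr fun t₀ ht₀ => ?_
    rw [uIcc_of_le (by linarith)] at ht₀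
    have h1 : |s - t₀| = t₀ - s := by rw [abs_sub_comm, abs_of_nonneg (by linarith [ht₀.1])]
    have h2 : 0 ≤ 1 - (t₀ - s) / r := by
      rw [sub_nonneg, div_le_one hr]; linarith [ht₀.2]
    simp only [h1, max_eq_left h2]
  rw [hcongr]
  have hderiv : ∀ t₀ ∈ uIcc s (s + r),
      HasDerivAt (fun t₀ => r⁻¹ * ((t₀ - s) - (t₀ - s) ^ 2 / (2 * r))) (r⁻¹ * (1 - (t₀ - s) / r)) t₀ := by
    intro t₀ _
    have h1 : HasDerivAt (fun t₀ : ℝ => t₀ - s) 1 t₀ := (hasDerivAt_id t₀).sub_const s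
    have h2 := (h1.pow 2).div_const (2 * r)
    have h3 := (h1.sub h2).const_mul r⁻¹
    refine h3.congr_deriv ?_
    rw [show (2 : ℕ) - 1 = 1 from rfl, pow_one]
    push_cast
    field_simp
  rw [intervalIntegral.integral_eq_sub_of_hasDerivAt hderiv ((continuous_const.mul (by fun_prop)).intervalIntegrable _ _)]
  field_simp
  ring

/-- **Unit mass**: `∫ bt = 1`. [folklore] -/
theorem integral_tent {r : ℝ} (hr : 0 < r) : ∫ a : ℝ, r⁻¹ * max (1 - |a| / r) 0 = 1 := by
  have hsupp : ∫ a : ℝ, r⁻¹ * max (1 - |a| / r) 0 = ∫ a in Icc (-r) r, r⁻¹ * max (1 - |a| / r) 0 := by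
    refine (setIntegral_eq_integral_of_forall_compl_eq_zero fun a ha => tent_eq_zero_of_le hr ?_).symm
    simp only [mem_Icc, not_and_or, not_le] at ha
    rcases ha with h | h
    · rw [abs_of_neg (by linarith)]; linarith
    · rw [abs_of_pos (by linarith)]; linarith
  rw [hsupp, integral_Icc_eq_integral_Ioc, ← intervalIntegral.integral_of_le (by linarith),
    ← intervalIntegral.integral_add_adjacent_intervals (b := 0)
      ((continuous_tent r).intervalIntegrable _ _) ((continuous_tent r).intervalIntegrable _ _)]
  -- left half, by reflection onto the right half computed in `integral_tent_half`
  have hright : ∫ a in (0 : ℝ)..r, r⁻¹ * max (1 - |a| / r) 0 = 1 / 2 := by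
    have h := integral_tent_half hr 0
    rw [zero_add] at h
    rw [← h]
    exact intervalIntegral.integral_congr fun a _ => by rw [zero_sub, abs_neg]
  have hleft : ∫ a in (-r)..(0 : ℝ), r⁻¹ * max (1 - |a| / r) 0 = 1 / 2 := by
    have h := intervalIntegral.integral_comp_neg (a := (0 : ℝ)) (b := r) (fun a => r⁻¹ * max (1 - |a| / r) 0)
    simp only [abs_neg, neg_zero] at h
    rw [← h]; exact hright
  rw [hleft, hright]; norm_num

/-- `∫ bt(s − t₀) dt₀ = 1`. [folklore] -/
theorem integral_tent_sub {r : ℝ} (hr : 0 < r) (s : ℝ) : ∫ t₀ : ℝ, r⁻¹ * max (1 - |s - t₀| / r) 0 = 1 :=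
  (integral_sub_left_eq_self (fun a : ℝ => r⁻¹ * max (1 - |a| / r) 0) volume s).trans (integral_tent hr)

/-- **Mass at most one on every set**: `∫_{t₀ ∈ S} bt(s − t₀) dt₀ ≤ 1`. [folklore] -/
theorem setIntegral_tent_le_one {r : ℝ} (hr : 0 < r) (s : ℝ) (S : Set ℝ) :
    ∫ t₀ in S, r⁻¹ * max (1 - |s - t₀| / r) 0 ≤ 1 :=
  (setIntegral_le_integral (integrable_tent_sub hr s)
    (ae_of_all _ fun _ => (ChaosClosesEulerWindowedInvariance.tent_nonneg_le hr _).1)).trans_eq (integral_tent_sub hr s)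

/-- The windowed tent mass is nonnegative. [folklore] -/
theorem setIntegral_tent_nonneg {r : ℝ} (hr : 0 < r) (s : ℝ) (S : Set ℝ) :
    0 ≤ ∫ t₀ in S, r⁻¹ * max (1 - |s - t₀| / r) 0 :=
  integral_nonneg fun t₀ => (ChaosClosesEulerWindowedInvariance.tent_nonneg_le hr (s - t₀)).1

/-- **Full mass on a window containing the support**: if `[s − r, s + r] ⊆ S` then `∫_{t₀ ∈ S} bt(s − t₀) dt₀ = 1`.
[folklore] -/
theorem setIntegral_tent_eq_one {r : ℝ} (hr : 0 < r) {s : ℝ} {S : Set ℝ} (hS : Icc (s - r) (s + r) ⊆ S) :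
    ∫ t₀ in S, r⁻¹ * max (1 - |s - t₀| / r) 0 = 1 := by
  refine Eq.trans ?_ (integral_tent_sub hr s)
  refine setIntegral_eq_integral_of_forall_compl_eq_zero fun t₀ ht₀ => tent_eq_zero_of_le hr ?_
  by_contra hlt
  push Not at hlt
  rw [abs_lt] at hlt
  exact ht₀ (hS ⟨by linarith [hlt.2], by linarith [hlt.1]⟩)

/-- **No mass off the support**: if `r ≤ |s − t₀|` for all `t₀ ∈ S` then `∫_{t₀ ∈ S} bt(s − t₀) dt₀ = 0`. [folklore] -/
theorem setIntegral_tent_eq_zero {r : ℝ} (hr : 0 < r) {s : ℝ} {S : Set ℝ} (hS : ∀ t₀ ∈ S, r ≤ |s - t₀|) :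
    ∫ t₀ in S, r⁻¹ * max (1 - |s - t₀| / r) 0 = 0 :=
  setIntegral_eq_zero_of_forall_eq_zero fun t₀ ht₀ => tent_eq_zero_of_le hr (hS t₀ ht₀)

/-- **At least half mass on a window containing the right half of the support**: if `[s, s + r] ⊆ [lo, hi]` then
`1/2 ≤ ∫_{t₀ ∈ [lo, hi]} bt(s − t₀) dt₀`. [folklore] -/
theorem half_le_setIntegral_tent {r : ℝ} (hr : 0 < r) {s lo hi : ℝ} (hlo : lo ≤ s) (hhi : s + r ≤ hi) :
    1 / 2 ≤ ∫ t₀ in Icc lo hi, r⁻¹ * max (1 - |s - t₀| / r) 0 := by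
  have hsub : Icc s (s + r) ⊆ Icc lo hi := Icc_subset_Icc hlo hhi
  calc (1 : ℝ) / 2 = ∫ t₀ in s..(s + r), r⁻¹ * max (1 - |s - t₀| / r) 0 := (integral_tent_half hr s).symm
    _ = ∫ t₀ in Icc s (s + r), r⁻¹ * max (1 - |s - t₀| / r) 0 := by
        rw [intervalIntegral.integral_of_le (by linarith), integral_Icc_eq_integral_Ioc]
    _ ≤ ∫ t₀ in Icc lo hi, r⁻¹ * max (1 - |s - t₀| / r) 0 :=
        setIntegral_mono_set (integrable_tent_sub hr s).integrableOn
          (ae_of_all _ fun t₀ => (ChaosClosesEulerWindowedInvariance.tent_nonneg_le hr (s - t₀)).1)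
          (ae_of_all _ hsub)

/-! ## §2 The space cone -/

/-- Where the cone does not vanish the minimal-image distance is `< r` (`0 < r`). [folklore] -/
theorem euclidDist_lt_of_cone_ne_zero {r : ℝ} (hr : 0 < r) {y x : T3} (h : cone r y x ≠ 0) :
    Torus.euclidDist y x < r := by
  by_contra hle
  push Not at hle
  refine h ?_
  unfold cone
  have h1 : 1 - Torus.euclidDist y x / r ≤ 0 := by
    rw [sub_nonpos, le_div_iff₀ hr, one_mul]; exact hle
  rw [max_eq_right h1, mul_zero]

/-- Where the tent does not vanish, `|a| < r` (`0 < r`). [folklore] -/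
theorem abs_lt_of_tent_ne_zero {r : ℝ} (hr : 0 < r) {a : ℝ} (h : r⁻¹ * max (1 - |a| / r) 0 ≠ 0) : |a| < r := by
  by_contra hle
  exact h (tent_eq_zero_of_le hr (not_lt.1 hle))

/-- A continuous space–time coefficient has a joint modulus on every compact time window: for `κ > 0` there is
`d > 0` with `|a(t₀, x₀) − a(s, x)| ≤ κ` whenever `s, t₀ ∈ [lo, hi]`, `|s − t₀| < d` and `dist(x, x₀) < d`
(minimal-image distance). [folklore] -/
theorem exists_modulus_spaceTime {a : ℝ × T3 → ℝ} (ha : Continuous a) (lo hi : ℝ) {κ : ℝ} (hκ : 0 < κ) :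
    ∃ d : ℝ, 0 < d ∧ ∀ s ∈ Icc lo hi, ∀ t₀ ∈ Icc lo hi, ∀ x x₀ : T3,
      |s - t₀| < d → Torus.euclidDist x x₀ < d → |a (t₀, x₀) - a (s, x)| ≤ κ := by
  have hK : IsCompact (Icc lo hi ×ˢ (univ : Set T3)) := isCompact_Icc.prod isCompact_univ
  obtain ⟨d, hd, hU⟩ := Metric.uniformContinuousOn_iff.1 (hK.uniformContinuousOn_of_continuous ha.continuousOn) κ hκ
  refine ⟨d, hd, fun s hs t₀ ht₀ x x₀ hst hxx => ?_⟩
  have h := hU (t₀, x₀) (mk_mem_prod ht₀ (mem_univ _)) (s, x) (mk_mem_prod hs (mem_univ _)) (by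
    rw [Prod.dist_eq, Real.dist_eq, abs_sub_comm]
    refine max_lt hst ?_
    calc dist x₀ x = ‖x₀ - x‖ := dist_eq_norm _ _
      _ ≤ Torus.euclidDist x₀ x := Torus.norm_sub_le_euclidDist_holds _ _
      _ = Torus.euclidDist x x₀ := Torus.euclidDist_comm _ _
      _ < d := hxx)
  rw [Real.dist_eq] at h
  exact h.le

/-! ## §3 The smoothed coefficient `ã(s, x) = ∫_{t₀ ∈ [0,t]} ∫_{x₀} a(t₀, x₀) bt(s − t₀) b_r(x, x₀)` -/

/-- The space integral `∫ a(t₀, x₀) b_r(x, x₀) dx₀` is continuous in `t₀` (parametric integral of a jointly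
continuous integrand over the compact torus). [folklore] -/
theorem continuous_integral_mul_cone {a : ℝ × T3 → ℝ} (ha : Continuous a) (r : ℝ) (x : T3) :
    Continuous fun t₀ : ℝ => ∫ x₀, a (t₀, x₀) * cone r x x₀ := by
  have hf : Continuous (Function.uncurry fun (t₀ : ℝ) (x₀ : T3) => a (t₀, x₀) * cone r x x₀) := by
    unfold Function.uncurry
    exact (ha.comp (continuous_fst.prodMk continuous_snd)).mul ((continuous_cone r x).comp continuous_snd)
  have h := continuous_parametric_integral_of_continuous (μ := (volume : Measure T3)) hf isCompact_univ
  simp only [Measure.restrict_univ] at h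
  exact h

/-- The inner integral of the smoothed coefficient: `∫ a (bt · b_r) dx₀ = bt(s − t₀) ∫ a b_r dx₀`. [folklore] -/
theorem integral_mul_tent_mul_cone (a : ℝ × T3 → ℝ) (r s t₀ : ℝ) (x : T3) :
    ∫ x₀, a (t₀, x₀) * (r⁻¹ * max (1 - |s - t₀| / r) 0 * cone r x x₀) =
      r⁻¹ * max (1 - |s - t₀| / r) 0 * ∫ x₀, a (t₀, x₀) * cone r x x₀ := by
  rw [← integral_const_mul]
  exact integral_congr_ae (ae_of_all _ fun x₀ => by ring)

/-- `|∫ a(t₀, x₀) b_r(x, x₀) dx₀| ≤ A` when `|a(t₀, ·)| ≤ A` (`0 < r < 1/2`: the cone is a probability density).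
[folklore] -/
theorem abs_integral_mul_cone_le {a : ℝ × T3 → ℝ} (ha : Continuous a) {r : ℝ} (hr : 0 < r) (hr2 : r < 1 / 2)
    {A : ℝ} {t₀ : ℝ} (hA : ∀ x₀, |a (t₀, x₀)| ≤ A) (x : T3) : |∫ x₀, a (t₀, x₀) * cone r x x₀| ≤ A := by
  have hc : Continuous fun x₀ => a (t₀, x₀) * cone r x x₀ :=
    (ha.comp (continuous_const.prodMk continuous_id)).mul (continuous_cone r x)
  calc |∫ x₀, a (t₀, x₀) * cone r x x₀| ≤ ∫ x₀, |a (t₀, x₀) * cone r x x₀| := abs_integral_le_integral_abs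
    _ ≤ ∫ x₀, A * cone r x x₀ := by
        refine integral_mono (integrable_of_continuous_T3 hc).abs
          ((integrable_of_continuous_T3 (continuous_cone r x)).const_mul A) fun x₀ => ?_
        rw [abs_mul, abs_of_nonneg (cone_nonneg hr _ _)]
        exact mul_le_mul_of_nonneg_right (hA x₀) (cone_nonneg hr _ _)
    _ = A := by
        have h1 : ∫ x₀, cone r x x₀ = 1 := integral_cone_eq_one hr hr2 x
        rw [integral_const_mul, h1, mul_one]

/-- `|∫ a(t₀, x₀) b_r(x, x₀) dx₀ − c| ≤ κ` when `|a(t₀, x₀) − c| ≤ κ` on the `r`-ball around `x`. [folklore] -/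
theorem abs_integral_mul_cone_sub_le {a : ℝ × T3 → ℝ} (ha : Continuous a) {r : ℝ} (hr : 0 < r) (hr2 : r < 1 / 2)
    {κ c : ℝ} {t₀ : ℝ} {x : T3} (hκ : ∀ x₀, Torus.euclidDist x x₀ < r → |a (t₀, x₀) - c| ≤ κ) :
    |(∫ x₀, a (t₀, x₀) * cone r x x₀) - c| ≤ κ := by
  have hc : Continuous fun x₀ => a (t₀, x₀) * cone r x x₀ :=
    (ha.comp (continuous_const.prodMk continuous_id)).mul (continuous_cone r x)
  have hcc : Continuous fun x₀ => (a (t₀, x₀) - c) * cone r x x₀ :=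
    ((ha.comp (continuous_const.prodMk continuous_id)).sub continuous_const).mul (continuous_cone r x)
  have heq : (∫ x₀, a (t₀, x₀) * cone r x x₀) - c = ∫ x₀, (a (t₀, x₀) - c) * cone r x x₀ := by
    have h1 : c = ∫ x₀, c * cone r x x₀ := by
      have h2 : ∫ x₀, cone r x x₀ = 1 := integral_cone_eq_one hr hr2 x
      rw [integral_const_mul, h2, mul_one]
    conv_lhs => rw [h1]
    rw [← integral_sub (integrable_of_continuous_T3 hc) ((integrable_of_continuous_T3 (continuous_cone r x)).const_mul c)]
    exact integral_congr_ae (ae_of_all _ fun x₀ => by ring)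
  rw [heq]
  calc |∫ x₀, (a (t₀, x₀) - c) * cone r x x₀| ≤ ∫ x₀, |(a (t₀, x₀) - c) * cone r x x₀| := abs_integral_le_integral_abs
    _ ≤ ∫ x₀, κ * cone r x x₀ := by
        refine integral_mono (integrable_of_continuous_T3 hcc).abs
          ((integrable_of_continuous_T3 (continuous_cone r x)).const_mul κ) fun x₀ => ?_
        rw [abs_mul, abs_of_nonneg (cone_nonneg hr _ _)]
        by_cases h0 : cone r x x₀ = 0
        · rw [h0, mul_zero, mul_zero]
        · exact mul_le_mul_of_nonneg_right (hκ x₀ (euclidDist_lt_of_cone_ne_zero hr h0)) (cone_nonneg hr _ _)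
    _ = κ := by
        have h2 : ∫ x₀, cone r x x₀ = 1 := integral_cone_eq_one hr hr2 x
        rw [integral_const_mul, h2, mul_one]

/-- **The smoothed coefficient is bounded by `sup |a|`** (`0 < r < 1/2`). [folklore] -/
theorem abs_smoothCoeff_le {a : ℝ × T3 → ℝ} (ha : Continuous a) {r : ℝ} (hr : 0 < r) (hr2 : r < 1 / 2)
    {A : ℝ} (hA : ∀ p, |a p| ≤ A) (t s : ℝ) (x : T3) :
    |∫ t₀ in Icc 0 t, ∫ x₀, a (t₀, x₀) * (r⁻¹ * max (1 - |s - t₀| / r) 0 * cone r x x₀)| ≤ A := by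
  have hA0 : 0 ≤ A := (abs_nonneg _).trans (hA (0, x))
  simp_rw [integral_mul_tent_mul_cone]
  calc |∫ t₀ in Icc 0 t, r⁻¹ * max (1 - |s - t₀| / r) 0 * ∫ x₀, a (t₀, x₀) * cone r x x₀|
      ≤ ∫ t₀ in Icc 0 t, |r⁻¹ * max (1 - |s - t₀| / r) 0 * ∫ x₀, a (t₀, x₀) * cone r x x₀| :=
        abs_integral_le_integral_abs
    _ ≤ ∫ t₀ in Icc 0 t, r⁻¹ * max (1 - |s - t₀| / r) 0 * A := by
        refine integral_mono_of_nonneg (ae_of_all _ fun _ => abs_nonneg _)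
          ((integrable_tent_sub hr s).integrableOn.mul_const A) (ae_of_all _ fun t₀ => ?_)
        have ht := ChaosClosesEulerWindowedInvariance.tent_nonneg_le hr (s - t₀)
        dsimp only
        rw [abs_mul, abs_of_nonneg ht.1]
        exact mul_le_mul_of_nonneg_left (abs_integral_mul_cone_le ha hr hr2 (fun x₀ => hA _) x) ht.1
    _ ≤ 1 * A := by
        rw [integral_mul_const]
        exact mul_le_mul_of_nonneg_right (setIntegral_tent_le_one hr s _) hA0
    _ = A := one_mul A

/-- **The smoothed coefficient is `r`-close to the coefficient away from the time ends**: for `s ∈ [r, t − r]`,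
`|ã(s, x) − a(s, x)| ≤ κ` whenever `κ` is a joint `r`-modulus of `a` at `(s, x)`. [folklore] -/
theorem abs_smoothCoeff_sub_le {a : ℝ × T3 → ℝ} (ha : Continuous a) {r : ℝ} (hr : 0 < r) (hr2 : r < 1 / 2)
    {t s : ℝ} (hs : r ≤ s) (hst : s + r ≤ t) {x : T3} {κ : ℝ}
    (hκ : ∀ (t₀ : ℝ) (x₀ : T3), |s - t₀| < r → Torus.euclidDist x x₀ < r → |a (t₀, x₀) - a (s, x)| ≤ κ) :
    |(∫ t₀ in Icc 0 t, ∫ x₀, a (t₀, x₀) * (r⁻¹ * max (1 - |s - t₀| / r) 0 * cone r x x₀)) - a (s, x)| ≤ κ := by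
  have hκ0 : 0 ≤ κ := (abs_nonneg _).trans (hκ s x (by simp [hr]) (by rw [Torus.euclidDist_self]; exact hr))
  simp_rw [integral_mul_tent_mul_cone]
  have hmass : ∫ t₀ in Icc 0 t, r⁻¹ * max (1 - |s - t₀| / r) 0 = 1 :=
    setIntegral_tent_eq_one hr (Icc_subset_Icc (by linarith) hst)
  have hG : Continuous fun t₀ : ℝ => ∫ x₀, a (t₀, x₀) * cone r x x₀ := continuous_integral_mul_cone ha r x
  have hI1 : IntegrableOn (fun t₀ => r⁻¹ * max (1 - |s - t₀| / r) 0 * ∫ x₀, a (t₀, x₀) * cone r x x₀) (Icc 0 t) :=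
    ((continuous_tent_sub r s).mul hG).continuousOn.integrableOn_compact isCompact_Icc
  have hI2 : IntegrableOn (fun t₀ => r⁻¹ * max (1 - |s - t₀| / r) 0 * a (s, x)) (Icc 0 t) :=
    (integrable_tent_sub hr s).integrableOn.mul_const _
  have heq : (∫ t₀ in Icc 0 t, r⁻¹ * max (1 - |s - t₀| / r) 0 * ∫ x₀, a (t₀, x₀) * cone r x x₀) - a (s, x) =
      ∫ t₀ in Icc 0 t, r⁻¹ * max (1 - |s - t₀| / r) 0 * ((∫ x₀, a (t₀, x₀) * cone r x x₀) - a (s, x)) := by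
    have h1 : a (s, x) = ∫ t₀ in Icc 0 t, r⁻¹ * max (1 - |s - t₀| / r) 0 * a (s, x) := by
      rw [integral_mul_const, hmass, one_mul]
    conv_lhs => rw [h1]
    rw [← integral_sub hI1 hI2]
    exact integral_congr_ae (ae_of_all _ fun t₀ => by ring)
  rw [heq]
  calc |∫ t₀ in Icc 0 t, r⁻¹ * max (1 - |s - t₀| / r) 0 * ((∫ x₀, a (t₀, x₀) * cone r x x₀) - a (s, x))|
      ≤ ∫ t₀ in Icc 0 t, |r⁻¹ * max (1 - |s - t₀| / r) 0 * ((∫ x₀, a (t₀, x₀) * cone r x x₀) - a (s, x))| :=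
        abs_integral_le_integral_abs
    _ ≤ ∫ t₀ in Icc 0 t, r⁻¹ * max (1 - |s - t₀| / r) 0 * κ := by
        refine integral_mono_of_nonneg (ae_of_all _ fun _ => abs_nonneg _)
          ((integrable_tent_sub hr s).integrableOn.mul_const κ) (ae_of_all _ fun t₀ => ?_)
        have ht := ChaosClosesEulerWindowedInvariance.tent_nonneg_le hr (s - t₀)
        dsimp only
        rw [abs_mul, abs_of_nonneg ht.1]
        by_cases h0 : r⁻¹ * max (1 - |s - t₀| / r) 0 = 0
        · rw [h0, zero_mul, zero_mul]
        · exact mul_le_mul_of_nonneg_left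
            (abs_integral_mul_cone_sub_le ha hr hr2 fun x₀ hx₀ => hκ t₀ x₀ (abs_lt_of_tent_ne_zero hr h0) hx₀) ht.1
    _ ≤ 1 * κ := by
        rw [integral_mul_const]
        exact mul_le_mul_of_nonneg_right (setIntegral_tent_le_one hr s _) hκ0
    _ = κ := one_mul κ

/-- **The smoothed coefficient vanishes past the window**: `ã(s, x) = 0` for `s ≥ t + r`. [folklore] -/
theorem smoothCoeff_eq_zero (a : ℝ × T3 → ℝ) {r : ℝ} (hr : 0 < r) {t s : ℝ} (hs : t + r ≤ s) (x : T3) :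
    ∫ t₀ in Icc 0 t, ∫ x₀, a (t₀, x₀) * (r⁻¹ * max (1 - |s - t₀| / r) 0 * cone r x x₀) = 0 := by
  refine setIntegral_eq_zero_of_forall_eq_zero fun t₀ ht₀ => ?_
  have h0 : r⁻¹ * max (1 - |s - t₀| / r) 0 = 0 :=
    tent_eq_zero_of_le hr (by rw [abs_of_nonneg (by linarith [ht₀.2])]; linarith [ht₀.2])
  simp only [h0, zero_mul, mul_zero, integral_zero]

/-! ## §4 Registered sub-goal -/

/-- **Registered sub-goal `stub_pressureValueC` (helper C of `stub_pressureValueOfEnskog`): the time tent has unit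
mass.** [folklore] -/
theorem stub_pressureValueC : ∀ {r : ℝ}, 0 < r → ∫ a : ℝ, r⁻¹ * max (1 - |a| / r) 0 = 1 :=
  fun hr => integral_tent hr

end Summit.AtomisticToContinuum.HydrodynamicLimit.Theorems.ChaosClosesEulerPressureValue

end
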